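import Summits.CriticalPhenomena.PercolationContinuityZ3.Theorems.PercNearOneGluingNoHeavyLowerTailSahiOneStepProfileGrid
import HarnessLib

/-!
# THE CHAIN RULE for `(2′)` (first of two files; the grid theorem is `…SahiOneStepProfileGridAndOr`)

Prover prim-ineq-prove-3 gen 45 (`--supports stmt-CriticalPhenomena-4575`; memo
`run/shared/lean/prim/prim-ineq-prove-3/PROOF-G45-CHAIN-RULE.md`).  Successor of `…SahiOneStepProfileGrid` (gen 44).

Write the one-step functional `n(1_A,1_B) = ℓ·μ(A∩B∩H) + μ(A∩L)μ(B∩L) − ℓ·μ(A)μ(B)` (`L = Hᶜ`, `ℓ = μ(L)`) in the form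
`(2′)(A,B) ⟺ μ(A|B) − μ(A) ≥ P(L|B)·[μ(A|B∩L) − μ(A|L)]`.
**CHAIN RULE.**  For up-sets `U₁, U₂`, `B = U₁ ∩ U₂` and `μ' = μ(·|U₁)`: if `(2′)_μ(A,U₁)`, `(2′)_{μ'}(A,U₂)` (same slot) and the three
Harris inequalities `μ(A|U₁) ≥ μ(A)`, `μ'(L|U₂) ≤ μ'(L)`, `μ(A|B) ≥ μ(A)` hold, then `(2′)_μ(A,B)`
(`chainRule_arith`, a division-free identity in the twelve cell masses).
On a product of `PF₂` chains with the Hamming slot `H = {Σ v_j ≥ t}` the conditioning on a coordinate cylinder `U₁ = {v_i ≥ c}`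
stays in the class (`IsLogConcaveSeq.truncGE`), so the gen-44 grid theorem `ProfileGrid.grid_osN_nonneg` (OR of coordinate
thresholds) bootstraps, by induction on the number of AND-constraints, to `(2′)` for every monotone density against
`B = {∀ i, c_i ≤ v_i} ∩ {∃ j, r_j ≤ v_j}` (`…ProfileGridAndOr`; cube theorem `…SahiOneStepDisjointAndOr`).
This file: `chainRule_arith`; `ite`-sum bookkeeping; the homogeneous cubic form `K̃` of `n` (written out; `gridK_smul` = joint
homogeneity, `fiveTerm_eq_gridK` = the five-term shape of `osN_ind_ind` when `⟨w⟩ = 1`); restriction of a product weight to a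
coordinate cylinder (`piWeight_update_truncGE`, `PF₂` preserved); Harris on a product of chains in numerator / event form
(`harris_numerator`, `harris_events`, from `FKGEqualityChains.cov_nonneg`).  No definitions, no sorries.
-/

noncomputable section

namespace Summit.CriticalPhenomena.PercolationContinuityZ3.Theorems

namespace SahiOneStep

namespace ProfileGrid

open Finset Function
open Literature.Probability.Distributions (IsLogConcaveSeq piWeight blockSum)
open Literature.Probability.LatticeModels.FKGEqualityChains (IsLogSupermodular cov cov_nonneg)
open Literature.Combinatorics.Sahi2008 (ex)
open scoped Classical

variable {κ : Type*} [Fintype κ] [DecidableEq κ] {N : ℕ}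

/-! ## The chain rule (arithmetic form) -/

/-- **THE CHAIN RULE for `(2′)`, division-free.**  Twelve cell masses: `M = μ(Ω)`, `l = μ(L)`, `a = μ_A(Ω)`, `al = μ_A(L)`;
`p1, pl1, a1, al1` the same four for `U₁`; `pB, plB, aB, alB` for `B = U₁ ∩ U₂` (`μ_A = a·μ` the numerator).  Hypotheses:
`H1 = (2′)_μ(A,U₁)`, `H2 = (2′)_{μ|U₁}(A,U₂)`, `H3, H4, H5` = Harris for `(A,U₁)` under `μ`, for `(H,U₂)` under `μ|U₁`, for `(A,B)`
under `μ` (only `H5`'s degenerate case `μ(U₁ ∩ L) = 0` uses `H5`).  Conclusion: `(2′)_μ(A,B)`.  Certificate: `G·p1·pl1 = M·l·H2 + pl1·pB·H1 + M·X·H4 = M·l·H2 + pl1·pB·l·H3 − p1·plB·M·X`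
with `X = l·al1 − al·pl1` (use the first form if `X ≥ 0`, the second if `X ≤ 0`). [this work] -/
theorem chainRule_arith {M l a al p1 pl1 a1 al1 pB plB aB alB : ℝ}
    (hM : 0 ≤ M) (hl : 0 ≤ l) (hp1 : 0 ≤ p1) (hpl1 : 0 ≤ pl1) (hpB : 0 ≤ pB) (hplB : 0 ≤ plB)
    (halB : 0 ≤ alB) (halBplB : alB ≤ plB) (hplBpB : plB ≤ pB) (hpBp1 : pB ≤ p1)
    (H1 : 0 ≤ M * l * (a1 - al1) + M * al * pl1 - l * a * p1)
    (H2 : 0 ≤ p1 * pl1 * (aB - alB) + p1 * al1 * plB - pl1 * a1 * pB)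
    (H3 : 0 ≤ a1 * M - a * p1) (H4 : 0 ≤ pl1 * pB - plB * p1) (H5 : 0 ≤ M * aB - a * pB) :
    0 ≤ M * l * (aB - alB) + M * al * plB - l * a * pB := by
  have key : 0 ≤ p1 * pl1 * (M * l * (aB - alB) + M * al * plB - l * a * pB) := by
    rcases le_total 0 (l * al1 - al * pl1) with hX | hX
    · have e : p1 * pl1 * (M * l * (aB - alB) + M * al * plB - l * a * pB) =
          M * l * (p1 * pl1 * (aB - alB) + p1 * al1 * plB - pl1 * a1 * pB)
          + pl1 * pB * (M * l * (a1 - al1) + M * al * pl1 - l * a * p1)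
          + M * (l * al1 - al * pl1) * (pl1 * pB - plB * p1) := by ring
      rw [e]
      have h1 := mul_nonneg (mul_nonneg hM hl) H2
      have h2 := mul_nonneg (mul_nonneg hpl1 hpB) H1
      have h3 := mul_nonneg (mul_nonneg hM hX) H4
      linarith
    · have hX' : 0 ≤ al * pl1 - l * al1 := by linarith
      have e : p1 * pl1 * (M * l * (aB - alB) + M * al * plB - l * a * pB) =
          M * l * (p1 * pl1 * (aB - alB) + p1 * al1 * plB - pl1 * a1 * pB)
          + pl1 * pB * l * (a1 * M - a * p1) + p1 * plB * M * (al * pl1 - l * al1) := by ring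
      rw [e]
      have h1 := mul_nonneg (mul_nonneg hM hl) H2
      have h2 := mul_nonneg (mul_nonneg (mul_nonneg hpl1 hpB) hl) H3
      have h3 := mul_nonneg (mul_nonneg (mul_nonneg hp1 hplB) hM) hX'
      linarith
  rcases (mul_nonneg hp1 hpl1).lt_or_eq with hpos | hzero
  · exact nonneg_of_mul_nonneg_right key hpos
  · -- degenerate: `p1 · pl1 = 0`, then `plB = alB = 0` and the goal is `l · H5 ≥ 0` (or everything vanishes)
    have hplB0 : plB = 0 := by
      rcases mul_eq_zero.1 hzero.symm with h | h
      · have : pB = 0 := le_antisymm (h ▸ hpBp1) hpB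
        exact le_antisymm (this ▸ hplBpB) hplB
      · rw [h, zero_mul, zero_sub] at H4
        nlinarith
    have halB0 : alB = 0 := le_antisymm (hplB0 ▸ halBplB) halB
    rw [hplB0, halB0, sub_zero, mul_zero, add_zero]
    have : M * l * aB - l * a * pB = l * (M * aB - a * pB) := by ring
    rw [this]; exact mul_nonneg hl H5

/-! ## Bookkeeping on `ite`-sums over the grid

All lemmas take the `Decidable` instances of BOTH sides as parameters, so that they rewrite structurally elaborated sums. -/

section Sums

/-- `ite`-sums along equivalent predicates agree (any instances). [folklore] -/
theorem sum_ite_congr_prop (f : (κ → Fin (N + 1)) → ℝ) {P Q : (κ → Fin (N + 1)) → Prop} [DecidablePred P] [DecidablePred Q]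
    (h : ∀ v, P v ↔ Q v) : (∑ v, if P v then f v else 0) = ∑ v, if Q v then f v else 0 :=
  Fintype.sum_congr _ _ fun v => by
    by_cases hq : Q v
    · rw [if_pos hq, if_pos ((h v).2 hq)]
    · rw [if_neg hq, if_neg (mt (h v).1 hq)]

/-- An `ite`-sum of a nonnegative function is monotone in the predicate. [folklore] -/
theorem sum_ite_le_of_imp {f : (κ → Fin (N + 1)) → ℝ} (hf : ∀ v, 0 ≤ f v) {P Q : (κ → Fin (N + 1)) → Prop}
    [DecidablePred P] [DecidablePred Q] (h : ∀ v, P v → Q v) :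
    (∑ v, if P v then f v else 0) ≤ ∑ v, if Q v then f v else 0 :=
  sum_le_sum fun v _ => by
    by_cases h1 : P v
    · rw [if_pos h1, if_pos (h v h1)]
    · rw [if_neg h1]; split_ifs <;> [exact hf v; exact le_rfl]

/-- An `ite`-sum is monotone in the function. [folklore] -/
theorem sum_ite_le_of_le {f g : (κ → Fin (N + 1)) → ℝ} (hfg : ∀ v, f v ≤ g v) (P : (κ → Fin (N + 1)) → Prop)
    [DecidablePred P] : (∑ v, if P v then f v else 0) ≤ ∑ v, if P v then g v else 0 :=
  sum_le_sum fun v _ => by split_ifs <;> [exact hfg v; exact le_rfl]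

/-- An `ite`-sum of a nonnegative function is nonnegative. [folklore] -/
theorem sum_ite_nonneg' {f : (κ → Fin (N + 1)) → ℝ} (hf : ∀ v, 0 ≤ f v) (P : (κ → Fin (N + 1)) → Prop) [DecidablePred P] :
    0 ≤ ∑ v, if P v then f v else 0 :=
  sum_nonneg fun v _ => by split_ifs <;> [exact hf v; exact le_rfl]

/-- Pulling a constant factor out of an `ite`. [folklore] -/
theorem ite_const_mul_zero (P : Prop) [Decidable P] (c x : ℝ) : (if P then c * x else 0) = c * if P then x else 0 := by
  split_ifs <;> simp

end Sums

/-! ## The homogeneous one-step functional on the grid -/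

section GridK

/-!
**The homogeneous (cubic) form of the one-step functional** for a weight `w` and a numerator `u` on the grid, slot
`H = {Σ_j v_j ≥ t}`, `L = Hᶜ`, second event `B`, is
`K̃(w,u;B) = Z·ℓ·⟨u 1_{H∩B}⟩ + Z·⟨u 1_L⟩·⟨w 1_{B∩L}⟩ − ℓ·⟨u⟩·⟨w 1_B⟩` with `Z = ⟨w⟩`, `ℓ = ⟨w 1_L⟩`
(written out in every statement below; for `Z = 1` it is `n(a,1_B) = ℓ·μ_a(B∩H) + μ_a(L)μ(B∩L) − ℓ·μ_a(Ω)μ(B)`).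
-/

/-- `K̃` depends on `B` only through its extension (any instances). [this work] -/
theorem gridK_congr_prop (t : ℕ) (w u : (κ → Fin (N + 1)) → ℝ) {B B' : (κ → Fin (N + 1)) → Prop} [DecidablePred B]
    [DecidablePred B'] (h : ∀ v, B v ↔ B' v) :
    (∑ v, w v) * (∑ v, if ¬ t ≤ blockSum univ v then w v else 0) * (∑ v, if t ≤ blockSum univ v ∧ B v then u v else 0)
        + (∑ v, w v) * (∑ v, if ¬ t ≤ blockSum univ v then u v else 0) * (∑ v, if B v ∧ ¬ t ≤ blockSum univ v then w v else 0)
        - (∑ v, if ¬ t ≤ blockSum univ v then w v else 0) * (∑ v, u v) * (∑ v, if B v then w v else 0) =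
      (∑ v, w v) * (∑ v, if ¬ t ≤ blockSum univ v then w v else 0) * (∑ v, if t ≤ blockSum univ v ∧ B' v then u v else 0)
        + (∑ v, w v) * (∑ v, if ¬ t ≤ blockSum univ v then u v else 0) * (∑ v, if B' v ∧ ¬ t ≤ blockSum univ v then w v else 0)
        - (∑ v, if ¬ t ≤ blockSum univ v then w v else 0) * (∑ v, u v) * (∑ v, if B' v then w v else 0) := by
  rw [sum_ite_congr_prop u (P := fun v => t ≤ blockSum univ v ∧ B v) (Q := fun v => t ≤ blockSum univ v ∧ B' v)
      (fun v => by rw [h v]),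
    sum_ite_congr_prop w (P := fun v => B v ∧ ¬ t ≤ blockSum univ v) (Q := fun v => B' v ∧ ¬ t ≤ blockSum univ v)
      (fun v => by rw [h v]),
    sum_ite_congr_prop w (P := B) (Q := B') h]

/-- `K̃` is jointly cubic: `K̃(c·w, c·u; B) = c³·K̃(w, u; B)`. [this work] -/
theorem gridK_smul (t : ℕ) (c : ℝ) (w u : (κ → Fin (N + 1)) → ℝ) (B : (κ → Fin (N + 1)) → Prop) [DecidablePred B] :
    (∑ v, c * w v) * (∑ v, if ¬ t ≤ blockSum univ v then c * w v else 0) * (∑ v, if t ≤ blockSum univ v ∧ B v then c * u v else 0)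
        + (∑ v, c * w v) * (∑ v, if ¬ t ≤ blockSum univ v then c * u v else 0) * (∑ v, if B v ∧ ¬ t ≤ blockSum univ v then c * w v else 0)
        - (∑ v, if ¬ t ≤ blockSum univ v then c * w v else 0) * (∑ v, c * u v) * (∑ v, if B v then c * w v else 0) =
      c ^ 3 * ((∑ v, w v) * (∑ v, if ¬ t ≤ blockSum univ v then w v else 0) * (∑ v, if t ≤ blockSum univ v ∧ B v then u v else 0)
          + (∑ v, w v) * (∑ v, if ¬ t ≤ blockSum univ v then u v else 0) * (∑ v, if B v ∧ ¬ t ≤ blockSum univ v then w v else 0)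
          - (∑ v, if ¬ t ≤ blockSum univ v then w v else 0) * (∑ v, u v) * (∑ v, if B v then w v else 0)) := by
  simp only [ite_const_mul_zero, ← mul_sum]
  ring

/-- If `Z = ⟨w⟩ = 1`, the five-term shape of `osN_ind_ind` equals `K̃`. [this work] -/
theorem fiveTerm_eq_gridK (t : ℕ) (w u : (κ → Fin (N + 1)) → ℝ) (B : (κ → Fin (N + 1)) → Prop) [DecidablePred B]
    (hZ : ∑ v, w v = 1) :
    (∑ v, if t ≤ blockSum univ v then u v else 0) * (∑ v, if t ≤ blockSum univ v ∧ B v then w v else 0)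
      + (1 - ∑ v, if t ≤ blockSum univ v then w v else 0) * (∑ v, if t ≤ blockSum univ v ∧ B v then u v else 0)
      + (∑ v, if t ≤ blockSum univ v then w v else 0) * (∑ v, u v) * (∑ v, if B v then w v else 0)
      - (∑ v, if t ≤ blockSum univ v then u v else 0) * (∑ v, if B v then w v else 0)
      - (∑ v, if t ≤ blockSum univ v ∧ B v then w v else 0) * (∑ v, u v) =
      (∑ v, w v) * (∑ v, if ¬ t ≤ blockSum univ v then w v else 0) * (∑ v, if t ≤ blockSum univ v ∧ B v then u v else 0)
        + (∑ v, w v) * (∑ v, if ¬ t ≤ blockSum univ v then u v else 0) * (∑ v, if B v ∧ ¬ t ≤ blockSum univ v then w v else 0)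
        - (∑ v, if ¬ t ≤ blockSum univ v then w v else 0) * (∑ v, u v) * (∑ v, if B v then w v else 0) := by
  rw [hZ, one_mul, one_mul]
  have eL : (∑ v, if ¬ t ≤ blockSum univ v then w v else 0) = 1 - ∑ v, if t ≤ blockSum univ v then w v else 0 := by
    rw [← hZ, sum_split w (fun v => t ≤ blockSum univ v)]; ring
  have eLu : (∑ v, if ¬ t ≤ blockSum univ v then u v else 0) =
      (∑ v, u v) - ∑ v, if t ≤ blockSum univ v then u v else 0 := by
    rw [sum_split u (fun v => t ≤ blockSum univ v)]; ring
  have eBL : (∑ v, if B v ∧ ¬ t ≤ blockSum univ v then w v else 0) =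
      (∑ v, if B v then w v else 0) - ∑ v, if t ≤ blockSum univ v ∧ B v then w v else 0 := by
    rw [sum_ite_split w B (fun v => t ≤ blockSum univ v),
      sum_ite_congr_prop w (P := fun v => B v ∧ t ≤ blockSum univ v) (Q := fun v => t ≤ blockSum univ v ∧ B v)
        (fun v => and_comm)]
    ring
  rw [eL, eLu, eBL]
  ring

end GridK

/-! ## Product weights: scaling, one-coordinate restriction, Harris -/

section Weights

omit [DecidableEq κ] in
/-- Scaling the factors scales the product weight. [folklore] -/
theorem piWeight_const_mul (c : κ → ℝ) (φ : κ → ℕ → ℝ) (v : κ → Fin (N + 1)) :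
    piWeight N (fun j n => c j * φ j n) v = (∏ j, c j) * piWeight N φ v := by
  unfold piWeight; rw [← prod_mul_distrib]

/-- The total mass of a product weight is the product of the factor masses. [folklore] -/
theorem sum_piWeight_eq_prod (φ : κ → ℕ → ℝ) : ∑ v : κ → Fin (N + 1), piWeight N φ v = ∏ j, ∑ n : Fin (N + 1), φ j n := by
  unfold piWeight; rw [Fintype.prod_sum]

/-- **Restriction to a coordinate cylinder**: zeroing `φ_i` below `c` multiplies the product weight by `1[c ≤ v_i]`. [folklore] -/
theorem piWeight_update_truncGE (φ : κ → ℕ → ℝ) (i : κ) (c : ℕ) (v : κ → Fin (N + 1)) :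
    piWeight N (update φ i (fun n => if c ≤ n then φ i n else 0)) v =
      if c ≤ (v i : ℕ) then piWeight N φ v else 0 := by
  rw [piWeight_eq_mul_erase _ i, piWeight_eq_mul_erase φ i, update_self]
  have : ∏ j ∈ univ.erase i, update φ i (fun n => if c ≤ n then φ i n else 0) j (v j) = ∏ j ∈ univ.erase i, φ j (v j) :=
    prod_congr rfl fun j hj => by rw [update_of_ne (ne_of_mem_erase hj)]
  rw [this]
  split_ifs <;> simp

omit [Fintype κ] in
/-- The restricted factors are again `PF₂`. [cite: Karlin1968, Ch. 8 §1] -/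
theorem isLogConcaveSeq_update_truncGE {φ : κ → ℕ → ℝ} (hφ : ∀ j, IsLogConcaveSeq (φ j)) (i : κ) (c : ℕ)
    (j : κ) : IsLogConcaveSeq (update φ i (fun n => if c ≤ n then φ i n else 0) j) := by
  by_cases hj : j = i
  · subst hj; rw [update_self]; exact (hφ j).truncGE c
  · rw [update_of_ne hj]; exact hφ j

omit [DecidableEq κ] in
/-- The product weight is log-supermodular on the product of chains (it is log-modular). [folklore] -/
theorem isLogSupermodular_piWeight (φ : κ → ℕ → ℝ) : IsLogSupermodular (piWeight N φ) :=
  isLogSupermodular_prod (fun j (n : Fin (N + 1)) => φ j n)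

omit [DecidableEq κ] in
/-- The Hamming slot is increasing on the grid. [folklore] -/
theorem slot_upper (t : ℕ) : ∀ v v' : κ → Fin (N + 1), v ≤ v' → t ≤ blockSum univ v → t ≤ blockSum univ v' :=
  fun v v' h ht => ht.trans (sum_le_sum fun j _ => by exact_mod_cast h j)

omit [Fintype κ] [DecidableEq κ] in
/-- The indicator of an increasing predicate is monotone. [folklore] -/
theorem monotone_ind_of_upper {P : (κ → Fin (N + 1)) → Prop} [DecidablePred P] (hP : ∀ v v', v ≤ v' → P v → P v') :
    Monotone fun v : κ → Fin (N + 1) => if P v then (1 : ℝ) else 0 := by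
  intro v v' h
  dsimp only
  by_cases h1 : P v
  · rw [if_pos h1, if_pos (hP v v' h h1)]
  · rw [if_neg h1]; split_ifs <;> norm_num

/-- **HARRIS on a product of chains, numerator form**: for `u = a·w` with `a` non-decreasing and an increasing `P`,
`⟨u⟩·⟨w 1_P⟩ ≤ ⟨w⟩·⟨u 1_P⟩` (Mathlib's four-functions theorem via `FKGEqualityChains.cov_nonneg`). [cite: FortuinKasteleynGinibre1971, Prop. 1] -/
theorem harris_numerator {φ : κ → ℕ → ℝ} (hφ0 : ∀ j n, 0 ≤ φ j n) {u a : (κ → Fin (N + 1)) → ℝ} (ha : Monotone a)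
    (hua : ∀ v, u v = a v * piWeight N φ v) {P : (κ → Fin (N + 1)) → Prop} [DecidablePred P]
    (hP : ∀ v v', v ≤ v' → P v → P v') :
    (∑ v, u v) * (∑ v, if P v then piWeight N φ v else 0) ≤
      (∑ v, piWeight N φ v) * ∑ v, if P v then u v else 0 := by
  have h := cov_nonneg (μ := piWeight N φ) (fun v => piWeight_nonneg hφ0 v) (isLogSupermodular_piWeight φ) ha
    (monotone_ind_of_upper hP)
  rw [cov, ex, ex, ex, sub_nonneg] at h
  have e1 : ∑ v, piWeight N φ v * (a * fun v => if P v then (1 : ℝ) else 0) v = ∑ v, if P v then u v else 0 :=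
    Fintype.sum_congr _ _ fun v => by simp only [Pi.mul_apply, hua v]; split_ifs <;> ring
  have e2 : ∑ v, piWeight N φ v * a v = ∑ v, u v := Fintype.sum_congr _ _ fun v => by rw [hua v, mul_comm]
  have e3 : ∑ v, piWeight N φ v * (if P v then (1 : ℝ) else 0) = ∑ v, if P v then piWeight N φ v else 0 :=
    Fintype.sum_congr _ _ fun v => by split_ifs <;> simp
  rw [e1, e2, e3] at h
  exact h

/-- **HARRIS for two increasing events** under a product weight: `⟨w 1_P⟩·⟨w 1_Q⟩ ≤ ⟨w⟩·⟨w 1_{P∧Q}⟩`. [cite: FortuinKasteleynGinibre1971, Prop. 1] -/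
theorem harris_events {φ : κ → ℕ → ℝ} (hφ0 : ∀ j n, 0 ≤ φ j n) {P Q : (κ → Fin (N + 1)) → Prop} [DecidablePred P]
    [DecidablePred Q] (hP : ∀ v v', v ≤ v' → P v → P v') (hQ : ∀ v v', v ≤ v' → Q v → Q v') :
    (∑ v, if P v then piWeight N φ v else 0) * (∑ v, if Q v then piWeight N φ v else 0) ≤
      (∑ v, piWeight N φ v) * ∑ v, if P v ∧ Q v then piWeight N φ v else 0 := by
  have h := cov_nonneg (μ := piWeight N φ) (fun v => piWeight_nonneg hφ0 v) (isLogSupermodular_piWeight φ)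
    (monotone_ind_of_upper hP) (monotone_ind_of_upper hQ)
  rw [cov, ex, ex, ex, sub_nonneg] at h
  have e1 : ∑ v, piWeight N φ v * ((fun v => if P v then (1 : ℝ) else 0) * fun v => if Q v then (1 : ℝ) else 0) v =
      ∑ v, if P v ∧ Q v then piWeight N φ v else 0 :=
    Fintype.sum_congr _ _ fun v => by
      simp only [Pi.mul_apply]; by_cases h1 : P v <;> by_cases h2 : Q v <;> simp [h1, h2]
  have e2 : ∑ v, piWeight N φ v * (if P v then (1 : ℝ) else 0) = ∑ v, if P v then piWeight N φ v else 0 :=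
    Fintype.sum_congr _ _ fun v => by split_ifs <;> simp
  have e3 : ∑ v, piWeight N φ v * (if Q v then (1 : ℝ) else 0) = ∑ v, if Q v then piWeight N φ v else 0 :=
    Fintype.sum_congr _ _ fun v => by split_ifs <;> simp
  rw [e1, e2, e3] at h
  exact h

end Weights

end ProfileGrid

end SahiOneStep

end Summit.CriticalPhenomena.PercolationContinuityZ3.Theorems
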